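import Summits.QuantumFields.YangMills.Theses.LangevinControlUV
import Literature.MathematicalPhysics.QuantumFieldTheory.LatticeGaugeProofs
import Literature.Barriers.QuantumFields.DiscreteSubgroupFreezing
import Literature.Barriers.QuantumFields.ElitzurTheorem

/-!
# `LatticeGapInUVUnits` — negative-side support: weak-coupling concentration on a fixed torus

Support file for crux `stmt-QuantumFields-9366` (`LangevinControlUV.LatticeGapInUVUnits`, the imported infrared
leg of route `LangevinControlUV`), extracted from the standing disprover's work file
`Cruxes/LatticeGapInUVUnits/Disproof.lean` (§3, §6). Every statement is about the tree's OWN objects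
(`wilsonMeasure`, `wilsonExpectation`, `wilsonAction`, `plaquetteCost`, `LatticeRep`); nothing is posited and no
definition is introduced.

* `neg_card_le_re_trace` (`−N ≤ Re tr U` for unitary `U`), `plaquetteCost_nonneg`, `plaquetteCost_le`,
  `abs_plaquetteCost_le`, `continuous_plaquetteCost`, `wilsonAction_nonneg'`, `plaquetteCost_le_wilsonAction`,
  `wilsonAction_one'`: the plaquette cost `N − Re tr r(U_p)` (tree `plaquetteCost`, = the field `P` of the route's
  femto two-point package) is continuous, lies in `[0, 2N]`, is dominated by the (non-negative) Wilson action, and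
  the trivial configuration has zero action.
* `wilsonMeasure_real_action_ge_le` — **weak-coupling concentration of the fixed-torus Wilson measure on the
  zero-action set**: `μ_{β,L}{S ≥ ε} ≤ e^{−βε/2} / p(ε, L, r)` for all `β ≥ 0` (Laplace principle: `S ≥ 0` is
  continuous with `S(1) = 0` and the product Haar measure charges open sets).
* `tendsto_wilsonExpectation_plaquetteCost` (`E_{β,L}[P_p] → 0`) and `tendsto_cov_plaquetteCost`
  (`Cov_{β,L}(P_p, P_q) → 0`) as `β → ∞` at fixed `L` — the formal shadow of "`n⁸ Cov = O(g₀⁴)` at one lattice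
  spacing".
* `shape_tendsto_zero_of_femto_lower_bound`: the LOWER half `c Γ(a(β)) ≤ Cov_{β,8}(P₀^{01}, P_{e₂}^{01})` of the
  route's femto package at the box `L = 8`, `n = 1` forces `Γ(a(β)) → 0` — no femto package of
  `FemtoCurvatureTwoPoint` / `FemtoCurvatureSkewness` / `LatticeGapInUVUnits` / `OSLegsFromFemtoAndGap` has a shape
  function bounded below on `(0, ℓ₀]` (tightness of their hypothesis `0 < Γ`).
* `wilsonExpectation_eq_apply_one_of_subsingleton`, `not_femto_lower_bound_of_subsingleton`: for a trivial gauge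
  group every plaquette covariance vanishes, so the femto lower bound is unsatisfiable — deleting
  `IsCompactSimpleLieGroup` opens no junk refutation of these cruxes. [folklore]
-/

namespace Summit.QuantumFields.YangMills.Theorems.LatticeGapInUVUnits.Negative

open Filter Topology MeasureTheory
open Literature.MathematicalPhysics.QuantumFieldTheory Literature.MathematicalPhysics.QuantumLattice

noncomputable section

variable {G : Type} [Group G] [TopologicalSpace G] [IsTopologicalGroup G] [CompactSpace G]
  [MeasurableSpace G] [BorelSpace G]

/-! ## The plaquette cost and the Wilson action -/

omit [Group G] [TopologicalSpace G] [IsTopologicalGroup G] [CompactSpace G] [MeasurableSpace G] [BorelSpace G] in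
/-- `−N ≤ Re tr U` for a unitary `N × N` matrix (entries bounded by `1`). [folklore] -/
theorem neg_card_le_re_trace {N : ℕ} {U : Matrix (Fin N) (Fin N) ℂ} (hU : U ∈ Matrix.unitaryGroup (Fin N) ℂ) :
    -(N : ℝ) ≤ U.trace.re := by
  have h : ∑ _i : Fin N, (-1 : ℝ) ≤ ∑ i, (U i i).re :=
    Finset.sum_le_sum fun i _ =>
      (abs_le.1 ((Complex.abs_re_le_norm (U i i)).trans (entry_norm_bound_of_unitary hU i i))).1
  calc -(N : ℝ) = ∑ _i : Fin N, (-1 : ℝ) := by simp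
    _ ≤ ∑ i, (U i i).re := h
    _ = U.trace.re := by rw [Matrix.trace]; simp [Complex.re_sum]

omit [IsTopologicalGroup G] [CompactSpace G] [MeasurableSpace G] [BorelSpace G] in
/-- `0 ≤ N − Re tr r(U_p)`. [folklore] -/
theorem plaquetteCost_nonneg (r : LatticeRep G) {L : ℕ} [NeZero L] (U : GaugeConfig 4 L G) (p : Plaquette 4 L) :
    0 ≤ plaquetteCost r.ρ U p :=
  sub_nonneg.2 (Literature.Barriers.QuantumFields.re_trace_le_of_mem_unitaryGroup (r.mem_unitary _))

omit [IsTopologicalGroup G] [CompactSpace G] [MeasurableSpace G] [BorelSpace G] in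
/-- `N − Re tr r(U_p) ≤ 2N`. [folklore] -/
theorem plaquetteCost_le (r : LatticeRep G) {L : ℕ} [NeZero L] (U : GaugeConfig 4 L G) (p : Plaquette 4 L) :
    plaquetteCost r.ρ U p ≤ 2 * r.N := by
  have := neg_card_le_re_trace (r.mem_unitary (plaquetteHolonomy U p.1 p.2.1.1 p.2.1.2))
  unfold plaquetteCost
  linarith

omit [IsTopologicalGroup G] [CompactSpace G] [MeasurableSpace G] [BorelSpace G] in
/-- `|N − Re tr r(U_p)| ≤ 2N`. [folklore] -/
theorem abs_plaquetteCost_le (r : LatticeRep G) {L : ℕ} [NeZero L] (U : GaugeConfig 4 L G)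
    (p : Plaquette 4 L) : |plaquetteCost r.ρ U p| ≤ 2 * r.N :=
  abs_le.2 ⟨by linarith [plaquetteCost_nonneg r U p, plaquetteCost_le r U p], plaquetteCost_le r U p⟩

omit [CompactSpace G] [MeasurableSpace G] [BorelSpace G] in
/-- The plaquette cost is continuous in the configuration. [folklore] -/
theorem continuous_plaquetteCost (r : LatticeRep G) {L : ℕ} [NeZero L] (p : Plaquette 4 L) :
    Continuous fun U : GaugeConfig 4 L G => plaquetteCost r.ρ U p := by
  have h1 : Continuous fun U : GaugeConfig 4 L G => plaquetteHolonomy U p.1 p.2.1.1 p.2.1.2 := by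
    unfold plaquetteHolonomy; fun_prop
  unfold plaquetteCost
  exact continuous_const.sub (Complex.continuous_re.comp (r.continuous.comp h1).matrix_trace)

omit [IsTopologicalGroup G] [CompactSpace G] [MeasurableSpace G] [BorelSpace G] in
/-- The Wilson action is non-negative (unitary representation). [folklore] -/
theorem wilsonAction_nonneg' (r : LatticeRep G) {L : ℕ} [NeZero L] (U : GaugeConfig 4 L G) :
    0 ≤ wilsonAction (d := 4) (L := L) r.ρ U :=
  Finset.sum_nonneg fun p _ => plaquetteCost_nonneg r U p

omit [IsTopologicalGroup G] [CompactSpace G] [MeasurableSpace G] [BorelSpace G] in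
/-- A single plaquette is dominated by the action (all other terms are non-negative). [folklore] -/
theorem plaquetteCost_le_wilsonAction (r : LatticeRep G) {L : ℕ} [NeZero L] (U : GaugeConfig 4 L G)
    (p : Plaquette 4 L) : plaquetteCost r.ρ U p ≤ wilsonAction (d := 4) (L := L) r.ρ U := by
  have h := Finset.single_le_sum (f := fun q : Plaquette 4 L => plaquetteCost r.ρ U q)
    (fun q _ => plaquetteCost_nonneg r U q) (Finset.mem_univ p)
  simpa only [wilsonAction, plaquetteCost] using h

omit [IsTopologicalGroup G] [CompactSpace G] [MeasurableSpace G] [BorelSpace G] in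
/-- The trivial configuration has zero action. [folklore] -/
theorem wilsonAction_one' (r : LatticeRep G) {L : ℕ} [NeZero L] :
    wilsonAction (d := 4) (L := L) r.ρ (1 : GaugeConfig 4 L G) = 0 := by
  unfold wilsonAction
  refine Finset.sum_eq_zero fun p _ => ?_
  simp [plaquetteHolonomy, Matrix.trace_one]

/-! ## Weak-coupling concentration on a fixed torus -/

/-- **Weak-coupling concentration of the fixed-torus Wilson measure on the zero-action set.** For every `ε > 0`
there is `p = p(ε, L, r) > 0` (the product-Haar mass of `{S < ε/2}`, positive because `S` is continuous, `S(1) = 0`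
and Haar charges open sets) with `μ_{β,L}{S ≥ ε} ≤ e^{−βε/2} / p` for all `β ≥ 0`: `Z ≥ e^{−βε/2} p` and the
weight of `{S ≥ ε}` is at most `e^{−βε}` (Laplace principle). [folklore] -/
theorem wilsonMeasure_real_action_ge_le (r : LatticeRep G) (L : ℕ) [NeZero L] {ε : ℝ} (hε : 0 < ε) :
    ∃ p : ℝ, 0 < p ∧ ∀ β : ℝ, 0 ≤ β →
      (wilsonMeasure (d := 4) (L := L) r.ρ β).real {U | ε ≤ wilsonAction r.ρ U} ≤
        Real.exp (-(β * (ε / 2))) / p := by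
  haveI : SecondCountableTopology G :=
    (r.continuous.isClosedEmbedding r.injective).isEmbedding.secondCountableTopology
  set π : Measure (GaugeConfig 4 L G) := Measure.pi fun _ : Edge 4 L => haarProbability G with hπ
  haveI : (haarProbability G).IsOpenPosMeasure := by rw [haarProbability]; infer_instance
  haveI hπpos : π.IsOpenPosMeasure := by rw [hπ]; infer_instance
  have hScont : Continuous (wilsonAction (d := 4) (L := L) r.ρ : GaugeConfig 4 L G → ℝ) :=
    Literature.Barriers.QuantumFields.Elitzur.continuous_wilsonAction r.ρ r.continuous
  set O : Set (GaugeConfig 4 L G) := {U | wilsonAction (d := 4) (L := L) r.ρ U < ε / 2} with hO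
  have hOopen : IsOpen O := isOpen_lt hScont continuous_const
  have hOne : (1 : GaugeConfig 4 L G) ∈ O := by
    show wilsonAction (d := 4) (L := L) r.ρ 1 < ε / 2
    rw [wilsonAction_one' r]
    exact half_pos hε
  have hπO : 0 < π O := hOopen.measure_pos π ⟨1, hOne⟩
  have hπO' : π O ≠ ⊤ := measure_ne_top π O
  refine ⟨(π O).toReal, ENNReal.toReal_pos hπO.ne' hπO', fun β hβ => ?_⟩
  set Sε : Set (GaugeConfig 4 L G) := {U | ε ≤ wilsonAction (d := 4) (L := L) r.ρ U} with hSε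
  set f : GaugeConfig 4 L G → ENNReal :=
    fun U => ENNReal.ofReal (Real.exp (-β * wilsonAction (d := 4) (L := L) r.ρ U)) with hf
  have hfm : Measurable f :=
    (ENNReal.continuous_ofReal.comp (Real.continuous_exp.comp (continuous_const.mul hScont))).measurable
  have hZ_def : partitionFunction (d := 4) (L := L) r.ρ β = ∫⁻ U, f U ∂π := by
    simp only [partitionFunction, wilsonWeight, withDensity_apply _ MeasurableSet.univ,
      Measure.restrict_univ, hπ, hf]
  -- lower bound on the partition function from the neighbourhood `O` of the trivial configuration
  have hZlow : ENNReal.ofReal (Real.exp (-(β * (ε / 2)))) * π O ≤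
      partitionFunction (d := 4) (L := L) r.ρ β := by
    rw [hZ_def]
    calc ENNReal.ofReal (Real.exp (-(β * (ε / 2)))) * π O
        = ∫⁻ _U in O, ENNReal.ofReal (Real.exp (-(β * (ε / 2)))) ∂π := (setLIntegral_const O _).symm
      _ ≤ ∫⁻ U in O, f U ∂π := by
          refine setLIntegral_mono hfm fun U hU => ENNReal.ofReal_le_ofReal (Real.exp_le_exp.2 ?_)
          have hU' : wilsonAction (d := 4) (L := L) r.ρ U < ε / 2 := hU
          have := mul_le_mul_of_nonneg_left hU'.le hβ
          linarith
      _ ≤ ∫⁻ U, f U ∂π := setLIntegral_le_lintegral O f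
  -- upper bound on the weight of the large-action set
  have hW : wilsonWeight (d := 4) (L := L) r.ρ β Sε ≤ ENNReal.ofReal (Real.exp (-(β * ε))) := by
    have hWeq : wilsonWeight (d := 4) (L := L) r.ρ β Sε = ∫⁻ U in Sε, f U ∂π := by
      simp only [wilsonWeight, hπ, hf]
      rw [withDensity_apply']
    rw [hWeq]
    calc ∫⁻ U in Sε, f U ∂π ≤ ∫⁻ _U in Sε, ENNReal.ofReal (Real.exp (-(β * ε))) ∂π := by
          refine setLIntegral_mono measurable_const fun U hU =>
            ENNReal.ofReal_le_ofReal (Real.exp_le_exp.2 ?_)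
          have hU' : ε ≤ wilsonAction (d := 4) (L := L) r.ρ U := hU
          have := mul_le_mul_of_nonneg_left hU' hβ
          linarith
      _ = ENNReal.ofReal (Real.exp (-(β * ε))) * π Sε := setLIntegral_const _ _
      _ ≤ ENNReal.ofReal (Real.exp (-(β * ε))) * 1 := mul_le_mul' le_rfl prob_le_one
      _ = ENNReal.ofReal (Real.exp (-(β * ε))) := mul_one _
  have hμ : (wilsonMeasure (d := 4) (L := L) r.ρ β) Sε =
      (partitionFunction (d := 4) (L := L) r.ρ β)⁻¹ * wilsonWeight (d := 4) (L := L) r.ρ β Sε := by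
    simp [wilsonMeasure]
  have hne : ENNReal.ofReal (Real.exp (-(β * (ε / 2)))) * π O ≠ 0 :=
    mul_ne_zero (by simp [Real.exp_pos]) hπO.ne'
  have hbound : (wilsonMeasure (d := 4) (L := L) r.ρ β) Sε ≤
      (ENNReal.ofReal (Real.exp (-(β * (ε / 2)))) * π O)⁻¹ * ENNReal.ofReal (Real.exp (-(β * ε))) := by
    rw [hμ]
    exact mul_le_mul' (ENNReal.inv_le_inv.2 hZlow) hW
  have htop : (ENNReal.ofReal (Real.exp (-(β * (ε / 2)))) * π O)⁻¹ * ENNReal.ofReal (Real.exp (-(β * ε))) ≠ ⊤ :=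
    ENNReal.mul_ne_top (ENNReal.inv_ne_top.2 hne) ENNReal.ofReal_ne_top
  rw [measureReal_def]
  refine (ENNReal.toReal_mono htop hbound).trans (le_of_eq ?_)
  rw [ENNReal.toReal_mul, ENNReal.toReal_inv, ENNReal.toReal_mul, ENNReal.toReal_ofReal (Real.exp_pos _).le,
    ENNReal.toReal_ofReal (Real.exp_pos _).le]
  have hexp : Real.exp (-(β * ε)) = Real.exp (-(β * (ε / 2))) * Real.exp (-(β * (ε / 2))) := by
    rw [← Real.exp_add]; ring_nf
  rw [hexp]
  have hp : (π O).toReal ≠ 0 := (ENNReal.toReal_pos hπO.ne' hπO').ne'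
  have he : Real.exp (-(β * (ε / 2))) ≠ 0 := (Real.exp_pos _).ne'
  field_simp

/-- **The mean plaquette cost vanishes at weak coupling on a fixed torus**: `E_{β,L}[P_p] → 0` as `β → ∞`
(`0 ≤ P_p ≤ S` pointwise, `P_p ≤ 2N`, and concentration). [folklore] -/
theorem tendsto_wilsonExpectation_plaquetteCost (r : LatticeRep G) (L : ℕ) [NeZero L] (p : Plaquette 4 L) :
    Tendsto (fun β => wilsonExpectation (d := 4) (L := L) r.ρ β fun U => plaquetteCost r.ρ U p) atTop (𝓝 0) := by
  haveI : SecondCountableTopology G :=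
    (r.continuous.isClosedEmbedding r.injective).isEmbedding.secondCountableTopology
  have key : ∀ ε : ℝ, 0 < ε → ∃ c : ℝ, 0 < c ∧ ∀ β : ℝ, 0 ≤ β →
      wilsonExpectation (d := 4) (L := L) r.ρ β (fun U => plaquetteCost r.ρ U p) ≤
        ε + 2 * r.N * (Real.exp (-(β * (ε / 2))) / c) := by
    intro ε hε
    obtain ⟨c, hc, hconc⟩ := wilsonMeasure_real_action_ge_le r L hε
    refine ⟨c, hc, fun β hβ => ?_⟩
    haveI := isProbabilityMeasure_wilsonMeasure (d := 4) (L := L) r.ρ r.continuous β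
    set μ := wilsonMeasure (d := 4) (L := L) r.ρ β with hμ
    set Sε : Set (GaugeConfig 4 L G) := {U | ε ≤ wilsonAction (d := 4) (L := L) r.ρ U} with hSε
    have hSm : MeasurableSet Sε :=
      measurableSet_le measurable_const (measurable_wilsonAction (d := 4) (L := L) r.ρ r.continuous)
    have hpt : ∀ U, plaquetteCost r.ρ U p ≤ ε + 2 * r.N * Sε.indicator (fun _ => (1 : ℝ)) U := by
      intro U
      by_cases hU : U ∈ Sε
      · rw [Set.indicator_of_mem hU, mul_one]
        have := plaquetteCost_le r U p
        linarith
      · rw [Set.indicator_of_notMem hU, mul_zero, add_zero]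
        have hlt : wilsonAction (d := 4) (L := L) r.ρ U < ε := not_le.1 hU
        exact (plaquetteCost_le_wilsonAction r U p).trans hlt.le
    have hint1 : Integrable (fun U => plaquetteCost r.ρ U p) μ :=
      Integrable.of_bound (continuous_plaquetteCost r p).aestronglyMeasurable (2 * r.N)
        (Eventually.of_forall fun U => by rw [Real.norm_eq_abs]; exact abs_plaquetteCost_le r U p)
    have hint2 : Integrable (fun U => ε + 2 * r.N * Sε.indicator (fun _ => (1 : ℝ)) U) μ :=
      (integrable_const ε).add (((integrable_const (1 : ℝ)).indicator hSm).const_mul (2 * (r.N : ℝ)))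
    calc wilsonExpectation (d := 4) (L := L) r.ρ β (fun U => plaquetteCost r.ρ U p)
        = ∫ U, plaquetteCost r.ρ U p ∂μ := rfl
      _ ≤ ∫ U, (ε + 2 * r.N * Sε.indicator (fun _ => (1 : ℝ)) U) ∂μ := integral_mono hint1 hint2 hpt
      _ = ε + 2 * r.N * μ.real Sε := by
          rw [integral_add (integrable_const ε)
            (((integrable_const (1 : ℝ)).indicator hSm).const_mul (2 * (r.N : ℝ))),
            integral_const, integral_const_mul, integral_indicator_const _ hSm]
          simp
      _ ≤ ε + 2 * r.N * (Real.exp (-(β * (ε / 2))) / c) := by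
          have hN : (0 : ℝ) ≤ 2 * r.N := by positivity
          have := hconc β hβ
          nlinarith
  rw [tendsto_order]
  refine ⟨fun δ hδ => Eventually.of_forall fun β => hδ.trans_le ?_, fun δ hδ => ?_⟩
  · exact integral_nonneg fun U => plaquetteCost_nonneg r U p
  · obtain ⟨c, hc, hkey⟩ := key (δ / 2) (half_pos hδ)
    have ht : Tendsto (fun β : ℝ => 2 * (r.N : ℝ) * (Real.exp (-(β * (δ / 2 / 2))) / c)) atTop (𝓝 0) := by
      have h1 : Tendsto (fun β : ℝ => Real.exp (-(β * (δ / 2 / 2)))) atTop (𝓝 0) :=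
        Real.tendsto_exp_atBot.comp
          (tendsto_neg_atTop_atBot.comp (tendsto_id.atTop_mul_const (by positivity)))
      simpa using (h1.div_const c).const_mul (2 * (r.N : ℝ))
    have hev : ∀ᶠ β : ℝ in atTop, 2 * (r.N : ℝ) * (Real.exp (-(β * (δ / 2 / 2))) / c) < δ / 2 :=
      (tendsto_order.1 ht).2 _ (half_pos hδ)
    filter_upwards [hev, eventually_ge_atTop (0 : ℝ)] with β hβ hβ0
    calc wilsonExpectation (d := 4) (L := L) r.ρ β (fun U => plaquetteCost r.ρ U p)
        ≤ δ / 2 + 2 * r.N * (Real.exp (-(β * (δ / 2 / 2))) / c) := hkey β hβ0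
      _ < δ / 2 + δ / 2 := by linarith
      _ = δ := by ring

/-- **Plaquette covariances vanish at weak coupling on a fixed torus**: for all plaquettes `p, q`,
`Cov_{β,L}(P_p, P_q) → 0` as `β → ∞` (`0 ≤ E[P_p P_q] ≤ 2N E[P_q] → 0` and `E[P_p] E[P_q] → 0`). The formal shadow of
`n⁸ Cov = O(g₀⁴) = O(β⁻²)` at the scale of one lattice spacing. [folklore] -/
theorem tendsto_cov_plaquetteCost (r : LatticeRep G) (L : ℕ) [NeZero L] (p q : Plaquette 4 L) :
    Tendsto (fun β =>
      wilsonExpectation (d := 4) (L := L) r.ρ β (fun U => plaquetteCost r.ρ U p * plaquetteCost r.ρ U q) -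
        wilsonExpectation (d := 4) (L := L) r.ρ β (fun U => plaquetteCost r.ρ U p) *
          wilsonExpectation (d := 4) (L := L) r.ρ β (fun U => plaquetteCost r.ρ U q)) atTop (𝓝 0) := by
  haveI : SecondCountableTopology G :=
    (r.continuous.isClosedEmbedding r.injective).isEmbedding.secondCountableTopology
  have h1 := tendsto_wilsonExpectation_plaquetteCost r L p
  have h2 := tendsto_wilsonExpectation_plaquetteCost r L q
  have h3 : Tendsto (fun β => wilsonExpectation (d := 4) (L := L) r.ρ β
      (fun U => plaquetteCost r.ρ U p * plaquetteCost r.ρ U q)) atTop (𝓝 0) := by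
    refine tendsto_of_tendsto_of_tendsto_of_le_of_le tendsto_const_nhds
      (by simpa using h2.const_mul (2 * (r.N : ℝ))) (fun β => ?_) (fun β => ?_)
    · exact integral_nonneg fun U => mul_nonneg (plaquetteCost_nonneg r U p) (plaquetteCost_nonneg r U q)
    · haveI := isProbabilityMeasure_wilsonMeasure (d := 4) (L := L) r.ρ r.continuous β
      have hintR : Integrable (fun U => 2 * (r.N : ℝ) * plaquetteCost r.ρ U q)
          (wilsonMeasure (d := 4) (L := L) r.ρ β) :=
        (Integrable.of_bound (continuous_plaquetteCost r q).aestronglyMeasurable (2 * r.N)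
          (Eventually.of_forall fun U => by
            rw [Real.norm_eq_abs]; exact abs_plaquetteCost_le r U q)).const_mul _
      have hintL : Integrable (fun U => plaquetteCost r.ρ U p * plaquetteCost r.ρ U q)
          (wilsonMeasure (d := 4) (L := L) r.ρ β) :=
        Integrable.of_bound ((continuous_plaquetteCost r p).mul (continuous_plaquetteCost r q)).aestronglyMeasurable
          (2 * r.N * (2 * r.N)) (Eventually.of_forall fun U => by
            rw [Real.norm_eq_abs, abs_mul]
            exact mul_le_mul (abs_plaquetteCost_le r U p) (abs_plaquetteCost_le r U q) (abs_nonneg _)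
              (by positivity))
      calc wilsonExpectation (d := 4) (L := L) r.ρ β (fun U => plaquetteCost r.ρ U p * plaquetteCost r.ρ U q)
          = ∫ U, plaquetteCost r.ρ U p * plaquetteCost r.ρ U q ∂(wilsonMeasure (d := 4) (L := L) r.ρ β) := rfl
        _ ≤ ∫ U, 2 * (r.N : ℝ) * plaquetteCost r.ρ U q ∂(wilsonMeasure (d := 4) (L := L) r.ρ β) :=
            integral_mono hintL hintR fun U =>
              mul_le_mul_of_nonneg_right (plaquetteCost_le r U p) (plaquetteCost_nonneg r U q)
        _ = 2 * (r.N : ℝ) * wilsonExpectation (d := 4) (L := L) r.ρ β (fun U => plaquetteCost r.ρ U q) :=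
            integral_const_mul _ _
  simpa using h3.sub (h1.mul h2)

/-! ## Consequences for the femto two-point package of route `LangevinControlUV` -/

/-- The plaquette of the `8⁴` torus at the origin in the `(0,1)` plane. [folklore] -/
theorem zero_lt_one_fin4 : (0 : Fin 4) < 1 := by decide

/-- **The femto LOWER bound forces the shape function to vanish along the unit map.** If for all large `β`
`c · Γ(a(β))` lies below the covariance of the two adjacent parallel plaquettes `P₀^{01}`, `P_{e₂}^{01}` of the
`8⁴` torus (the box `L = 8`, `n = 1` of the femto two-point package, available as soon as `8 a(β) ≤ ℓ₀`), with
`c > 0` and `Γ(a(β)) ≥ 0` eventually, then `Γ(a(β)) → 0` — by `tendsto_cov_plaquetteCost` the covariance itself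
tends to `0`. So no femto package of the route has a shape function bounded below on `(0, ℓ₀]`: the planner's
untyped "asymptotic-freedom dividend `Γ(s) → 0⁺`" is FORCED on the grid `s = a(β)` by concentration alone.
[folklore] -/
theorem shape_tendsto_zero_of_femto_lower_bound (r : LatticeRep G) {a Γ : ℝ → ℝ} {c : ℝ} (hc : 0 < c)
    (hΓ : ∀ᶠ β in atTop, 0 ≤ Γ (a β))
    (hlow : ∀ᶠ β in atTop, c * Γ (a β) ≤
      wilsonExpectation (d := 4) (L := 8) r.ρ β
          (fun U => plaquetteCost r.ρ U ((0 : Site 4 8), ⟨(0, 1), zero_lt_one_fin4⟩) *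
            plaquetteCost r.ρ U ((Pi.single (2 : Fin 4) (1 : ZMod 8) : Site 4 8), ⟨(0, 1), zero_lt_one_fin4⟩)) -
        wilsonExpectation (d := 4) (L := 8) r.ρ β
            (fun U => plaquetteCost r.ρ U ((0 : Site 4 8), ⟨(0, 1), zero_lt_one_fin4⟩)) *
          wilsonExpectation (d := 4) (L := 8) r.ρ β
            (fun U => plaquetteCost r.ρ U
              ((Pi.single (2 : Fin 4) (1 : ZMod 8) : Site 4 8), ⟨(0, 1), zero_lt_one_fin4⟩))) :
    Tendsto (fun β => Γ (a β)) atTop (𝓝 0) := by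
  haveI : NeZero (8 : ℕ) := ⟨by norm_num⟩
  have hcov0 := tendsto_cov_plaquetteCost r 8 ((0 : Site 4 8), ⟨(0, 1), zero_lt_one_fin4⟩)
    ((Pi.single (2 : Fin 4) (1 : ZMod 8) : Site 4 8), ⟨(0, 1), zero_lt_one_fin4⟩)
  refine tendsto_of_tendsto_of_tendsto_of_le_of_le' tendsto_const_nhds (by simpa using hcov0.div_const c) hΓ ?_
  filter_upwards [hlow] with β hβ
  rw [le_div_iff₀ hc]
  linarith

/-- For a trivial (subsingleton) gauge group every torus observable is constant, so every Wilson expectation is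
evaluation at the trivial configuration. [folklore] -/
theorem wilsonExpectation_eq_apply_one_of_subsingleton [Subsingleton G] (r : LatticeRep G) (β : ℝ) (L : ℕ)
    [NeZero L] (F : GaugeConfig 4 L G → ℝ) :
    wilsonExpectation (d := 4) (L := L) r.ρ β F = F 1 := by
  haveI := isProbabilityMeasure_wilsonMeasure (d := 4) (L := L) r.ρ r.continuous β
  have hF : F = fun _ => F 1 := funext fun U => congrArg F (Subsingleton.elim _ _)
  rw [hF]
  simp [wilsonExpectation]

/-- For a trivial gauge group the femto lower bound is contradictory at a single coupling: all plaquette covariances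
vanish, so `c γ ≤ Cov = 0` is incompatible with `c > 0`, `γ > 0` — the femto package of the route is UNSATISFIABLE
for a subsingleton `G` (no junk refutation of the four cruxes through the gauge group). [folklore] -/
theorem not_femto_lower_bound_of_subsingleton [Subsingleton G] (r : LatticeRep G) {L : ℕ} [NeZero L]
    (p q : Plaquette 4 L) (β : ℝ) {c γ : ℝ} (hc : 0 < c) (hγ : 0 < γ) :
    ¬ c * γ ≤ wilsonExpectation (d := 4) (L := L) r.ρ β (fun U => plaquetteCost r.ρ U p * plaquetteCost r.ρ U q) -
        wilsonExpectation (d := 4) (L := L) r.ρ β (fun U => plaquetteCost r.ρ U p) *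
          wilsonExpectation (d := 4) (L := L) r.ρ β (fun U => plaquetteCost r.ρ U q) := by
  simp only [wilsonExpectation_eq_apply_one_of_subsingleton, sub_self, not_le]
  exact mul_pos hc hγ

end

end Summit.QuantumFields.YangMills.Theorems.LatticeGapInUVUnits.Negative
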